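import Summits.Ventures.Crystal3D.Theorems.StickyWulffConstantGenericWallFloorNonChainCriterion
import Summits.Ventures.Crystal3D.Theorems.StickyWulffConstantCoaxialWallLawInPlaneSlot
import HarnessLib

/-!
# Foreign plates of a co-axial grain are steep: the sharp tilt bound

HONEST FRAMING. Part of the venture `Summits/Ventures/Crystal3D` (cell `crystal3d-full`), helper
`--supports` the crux `CoaxialWallLaw` (stmt-Ventures-19481, `route-Ventures-StickyWulffConstant`),
REGISTERED line `WallLedgerF` (planner cf-p1 gen 16), stub `stub_coaxialTwoSlabAdhesion`.  Input of the
WIDENED thin-wall law (next file): the residual-free vicinal law of `…CoaxialWallLawThinWall` needs every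
FOREIGN `{111}` plate met by an in-plane line of grain 1 to be non-horizontal, with an explicit descent rate;
the landed bound `√(1 − ⟪n,e₃⟫²) ≥ √(2/3) − sin θ` (`sqrt_two_thirds_le_tilt_add`) only covers `sin θ < √(2/3)`
and was used at `sin θ ≤ 2/5`.  Here is the sharp bound, valid on the whole range `tan θ < √8`
(`θ = ∠(e₃, L e₃)`), i.e. for every inclination of the shared axis except those at which a foreign `{111}`
plane of grain 1 can be horizontal (`θ ≥ arccos(1/3) = 70.53°`).  Rung credit only; F-C1 not moved.

* `menu_axis_of_coaxial` — under the crux's co-axiality hypothesis for grain 1, the shared axis `m = L e₃` is a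
  MENU NORMAL of the grain's frame: `⟪A₁ w, L e₃⟫ ∈ {0, ±√(2/3)}` for every slot `w` (heights along the axis are
  quantised, `barlowImage_inner_axis_sub`).
* `menu_cubic_coords_pm_one`, `inner_menu_normals` — a unit menu normal of a frame `G` has `G`-cubic coordinates
  `(±1, ±1, ±1)/√3`; hence two unit menu normals `n, m` of the same frame satisfy `⟪n, m⟫ ∈ {±1, ±1/3}`.
* `tilt_ge_of_inner_eq_third` — for unit `n, m` with `⟪n, m⟫ = ±1/3`:
  `(√8·|⟪m,e₃⟫| − √(1 − ⟪m,e₃⟫²))/3 ≤ √(1 − ⟪n,e₃⟫²)` (write `e₃ = ⟪m,e₃⟫ m + g`, `‖g‖ = sin θ`, and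
  `‖n − ⟪n,m⟫ m‖ = √8/3`).
* `foreign_descent_rate_of_coaxial` — packaging for the thin-wall law: every unit menu normal `n ≠ ±L e₃` of
  grain 1 has descent rate `(√3/2)·√(1 − ⟪n,e₃⟫²) ≥ (√3/6)·(√8·|⟪L e₃, e₃⟫| − √(1 − ⟪L e₃, e₃⟫²))`.

WHAT THIS IS NOT: not the stub; no statement about fillings; F-C1 not moved.
-/

noncomputable section

namespace Summit.Ventures.Crystal3D.Theorems

open Summit.Ventures.Crystal3D Finset
open Literature.MathematicalPhysics.StatisticalMechanics (fccStacking barlowStacking)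
open scoped InnerProductSpace

/-- **The shared axis is a menu normal of the grain.**  If `A₁·Λ₀ + t₁ ⊆ L·B(σ) + s₁` then for every slot
`w`, `⟪A₁ w, L e₃⟫ ∈ {0, √(2/3), −√(2/3)}`. -/
theorem menu_axis_of_coaxial
    (A₁ : EuclideanSpace ℝ (Fin 3) ≃ₗᵢ[ℝ] EuclideanSpace ℝ (Fin 3)) (t₁ : EuclideanSpace ℝ (Fin 3))
    (L : EuclideanSpace ℝ (Fin 3) ≃ₗᵢ[ℝ] EuclideanSpace ℝ (Fin 3)) (s₁ : EuclideanSpace ℝ (Fin 3)) (σ : ℤ → ℤ)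
    (hsub : (fun p => A₁ p + t₁) '' fccStacking 1 (Real.sqrt (2 / 3)) ⊆
      (fun p => L p + s₁) '' barlowStacking 1 (Real.sqrt (2 / 3)) σ) :
    ∀ w ∈ fccSlots, ⟪A₁ w, L (EuclideanSpace.single (2 : Fin 3) (1 : ℝ))⟫_ℝ = 0 ∨
      ⟪A₁ w, L (EuclideanSpace.single (2 : Fin 3) (1 : ℝ))⟫_ℝ = Real.sqrt (2 / 3) ∨
      ⟪A₁ w, L (EuclideanSpace.single (2 : Fin 3) (1 : ℝ))⟫_ℝ = -Real.sqrt (2 / 3) := by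
  intro w hw
  have hwΛ := mem_fcc_of_mem_fccSlots hw
  have hx : A₁ w + t₁ ∈ (fun p => A₁ p + t₁) '' fccStacking 1 (Real.sqrt (2 / 3)) := ⟨w, hwΛ, rfl⟩
  have hx' : A₁ (w + w) + t₁ ∈ (fun p => A₁ p + t₁) '' fccStacking 1 (Real.sqrt (2 / 3)) :=
    ⟨w + w, fcc_add_site_mem hwΛ hwΛ, rfl⟩
  obtain ⟨n, hn⟩ := barlowImage_inner_axis_sub L s₁ σ (hsub hx') (hsub hx)
  have e : A₁ (w + w) + t₁ - (A₁ w + t₁) = A₁ w := by rw [map_add]; abel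
  rw [e] at hn
  have hb : |⟪A₁ w, L (EuclideanSpace.single (2 : Fin 3) (1 : ℝ))⟫_ℝ| ≤ 1 := by
    have := abs_real_inner_le_norm (A₁ w) (L (EuclideanSpace.single (2 : Fin 3) (1 : ℝ)))
    rwa [LinearIsometryEquiv.norm_map, norm_eq_one_of_mem_fccSlots hw, LinearIsometryEquiv.norm_map,
      PiLp.norm_single, norm_one, one_mul] at this
  rw [hn] at hb ⊢
  have hr : (1 : ℝ) / 2 < Real.sqrt (2 / 3) := by
    rw [show (1 : ℝ) / 2 = Real.sqrt ((1 / 2) ^ 2) by rw [Real.sqrt_sq (by norm_num)]]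
    exact Real.sqrt_lt_sqrt (by norm_num) (by norm_num)
  have hr0 : 0 < Real.sqrt (2 / 3) := Real.sqrt_pos.2 (by norm_num)
  rw [abs_mul, abs_of_pos hr0] at hb
  have habs : |(n : ℝ)| < 2 := by
    by_contra hge
    push Not at hge
    have : (2 : ℝ) * (1 / 2) < |(n : ℝ)| * Real.sqrt (2 / 3) :=
      calc (2 : ℝ) * (1 / 2) < 2 * Real.sqrt (2 / 3) := by linarith
        _ ≤ |(n : ℝ)| * Real.sqrt (2 / 3) := mul_le_mul_of_nonneg_right hge hr0.le
    linarith
  have hn2 : -2 < n ∧ n < 2 := by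
    rw [← Int.cast_abs] at habs
    have : |n| < 2 := by exact_mod_cast habs
    exact abs_lt.1 this
  obtain ⟨h1, h2⟩ := hn2
  interval_cases n
  · right; right; simp
  · left; simp
  · right; left; simp

/-- Integers with `a² + b² + c² = 3` are all `±1`. -/
theorem pm_one_of_sum_sq_eq_three {a b c : ℤ} (h : a ^ 2 + b ^ 2 + c ^ 2 = 3) :
    (a = 1 ∨ a = -1) ∧ (b = 1 ∨ b = -1) ∧ (c = 1 ∨ c = -1) := by
  have ha : -1 ≤ a ∧ a ≤ 1 := by constructor <;> nlinarith [sq_nonneg b, sq_nonneg c, sq_nonneg (a + 1), sq_nonneg (a - 1)]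
  have hb : -1 ≤ b ∧ b ≤ 1 := by constructor <;> nlinarith [sq_nonneg a, sq_nonneg c, sq_nonneg (b + 1), sq_nonneg (b - 1)]
  have hc : -1 ≤ c ∧ c ≤ 1 := by constructor <;> nlinarith [sq_nonneg a, sq_nonneg b, sq_nonneg (c + 1), sq_nonneg (c - 1)]
  obtain ⟨ha1, ha2⟩ := ha
  obtain ⟨hb1, hb2⟩ := hb
  obtain ⟨hc1, hc2⟩ := hc
  interval_cases a <;> interval_cases b <;> interval_cases c <;> simp_all

/-- **Cubic coordinates of a unit menu normal are `±1/√3`.**  For a unit `m` with the slot menu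
`⟪G w, m⟫ ∈ {0, ±√(2/3)}` there are signs `kⱼ = ±1` with `⟪G cⱼ, m⟫ = kⱼ/√3` (`cⱼ` the cubic frame). -/
theorem menu_cubic_coords_pm_one (G : EuclideanSpace ℝ (Fin 3) ≃ₗᵢ[ℝ] EuclideanSpace ℝ (Fin 3))
    {m : EuclideanSpace ℝ (Fin 3)} (hm : ‖m‖ = 1)
    (hmenu : ∀ w ∈ fccSlots, ⟪G w, m⟫_ℝ = 0 ∨ ⟪G w, m⟫_ℝ = Real.sqrt (2 / 3) ∨ ⟪G w, m⟫_ℝ = -Real.sqrt (2 / 3)) :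
    ∃ k : Fin 3 → ℤ, (∀ j, k j = 1 ∨ k j = -1) ∧ ∀ j, ⟪G (cubicFrame j), m⟫_ℝ * Real.sqrt 3 = k j := by
  choose k hk using frame_inner_menu G hmenu
  have h23 : Real.sqrt (2 / 3) = Real.sqrt 2 / Real.sqrt 3 := by
    rw [Real.sqrt_div (by norm_num)]
  have hs2 : Real.sqrt 2 ≠ 0 := by positivity
  have hs3 : Real.sqrt 3 ≠ 0 := by positivity
  have hk' : ∀ j, ⟪G (cubicFrame j), m⟫_ℝ * Real.sqrt 3 = k j := by
    intro j
    have := hk j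
    rw [h23] at this
    field_simp at this
    linarith
  -- the coordinates are those of `G.symm m` in the cubic frame, whose squares sum to `‖m‖² = 1`
  have hcoord : ∀ j, ⟪G (cubicFrame j), m⟫_ℝ = cubicCoords (G.symm m) j := by
    intro j
    have h := G.inner_map_map (cubicFrame j) (G.symm m)
    rw [G.apply_symm_apply] at h
    rw [h, ← inner_cubicFrame, real_inner_comm]
  have hsum : ∑ j : Fin 3, ⟪G (cubicFrame j), m⟫_ℝ ^ 2 = 1 := by
    have h := norm_sq_eq_cubicCoords (G.symm m)
    rw [LinearIsometryEquiv.norm_map, hm, one_pow] at h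
    rw [h]
    simp only [dotProduct, hcoord, sq]
  have hsum3 : ∑ j : Fin 3, (⟪G (cubicFrame j), m⟫_ℝ * Real.sqrt 3) ^ 2 = 3 := by
    have h3 : Real.sqrt 3 ^ 2 = 3 := Real.sq_sqrt (by norm_num)
    simp only [mul_pow, ← Finset.sum_mul, hsum, h3, one_mul]
  simp only [hk', Fin.sum_univ_three] at hsum3
  have hint : k 0 ^ 2 + k 1 ^ 2 + k 2 ^ 2 = 3 := by exact_mod_cast hsum3
  obtain ⟨h0, h1, h2⟩ := pm_one_of_sum_sq_eq_three hint
  refine ⟨k, ?_, hk'⟩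
  intro j
  fin_cases j
  · exact h0
  · exact h1
  · exact h2

/-- **Two unit menu normals of one frame are equal up to sign or at `⟪n, m⟫ = ±1/3`.** -/
theorem inner_menu_normals (G : EuclideanSpace ℝ (Fin 3) ≃ₗᵢ[ℝ] EuclideanSpace ℝ (Fin 3))
    {n m : EuclideanSpace ℝ (Fin 3)} (hn : ‖n‖ = 1) (hm : ‖m‖ = 1)
    (hmenun : ∀ w ∈ fccSlots, ⟪G w, n⟫_ℝ = 0 ∨ ⟪G w, n⟫_ℝ = Real.sqrt (2 / 3) ∨ ⟪G w, n⟫_ℝ = -Real.sqrt (2 / 3))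
    (hmenum : ∀ w ∈ fccSlots, ⟪G w, m⟫_ℝ = 0 ∨ ⟪G w, m⟫_ℝ = Real.sqrt (2 / 3) ∨ ⟪G w, m⟫_ℝ = -Real.sqrt (2 / 3)) :
    ⟪n, m⟫_ℝ = 1 ∨ ⟪n, m⟫_ℝ = -1 ∨ ⟪n, m⟫_ℝ = 1 / 3 ∨ ⟪n, m⟫_ℝ = -(1 / 3) := by
  obtain ⟨k, hk, hkc⟩ := menu_cubic_coords_pm_one G hn hmenun
  obtain ⟨l, hl, hlc⟩ := menu_cubic_coords_pm_one G hm hmenum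
  -- Parseval in the frame `G cⱼ`
  have hcn : ∀ j, ⟪G (cubicFrame j), n⟫_ℝ = cubicCoords (G.symm n) j := by
    intro j
    have h := G.inner_map_map (cubicFrame j) (G.symm n)
    rw [G.apply_symm_apply] at h
    rw [h, ← inner_cubicFrame, real_inner_comm]
  have hcm : ∀ j, ⟪G (cubicFrame j), m⟫_ℝ = cubicCoords (G.symm m) j := by
    intro j
    have h := G.inner_map_map (cubicFrame j) (G.symm m)
    rw [G.apply_symm_apply] at h
    rw [h, ← inner_cubicFrame, real_inner_comm]
  have hpar : ⟪n, m⟫_ℝ = ∑ j : Fin 3, ⟪G (cubicFrame j), n⟫_ℝ * ⟪G (cubicFrame j), m⟫_ℝ := by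
    rw [← G.symm.inner_map_map, inner_eq_cubicCoords]
    simp only [dotProduct, hcn, hcm]
  have h3 : Real.sqrt 3 ^ 2 = 3 := Real.sq_sqrt (by norm_num)
  have hpar3 : ⟪n, m⟫_ℝ * 3 = ∑ j : Fin 3, (⟪G (cubicFrame j), n⟫_ℝ * Real.sqrt 3) * (⟪G (cubicFrame j), m⟫_ℝ * Real.sqrt 3) := by
    rw [hpar, Finset.sum_mul]
    refine Finset.sum_congr rfl fun j _ => ?_
    linear_combination (-(⟪G (cubicFrame j), n⟫_ℝ * ⟪G (cubicFrame j), m⟫_ℝ)) * h3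
  simp only [hkc, hlc, Fin.sum_univ_three] at hpar3
  have hprod : ∀ j, k j * l j = 1 ∨ k j * l j = -1 := by
    intro j; rcases hk j with h | h <;> rcases hl j with h' | h' <;> simp [h, h']
  have hP : k 0 * l 0 + k 1 * l 1 + k 2 * l 2 = 3 ∨ k 0 * l 0 + k 1 * l 1 + k 2 * l 2 = -3 ∨
      k 0 * l 0 + k 1 * l 1 + k 2 * l 2 = 1 ∨ k 0 * l 0 + k 1 * l 1 + k 2 * l 2 = -1 := by
    rcases hprod 0 with h0 | h0 <;> rcases hprod 1 with h1 | h1 <;> rcases hprod 2 with h2 | h2 <;> omega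
  have hpar3' : ⟪n, m⟫_ℝ * 3 = ((k 0 * l 0 + k 1 * l 1 + k 2 * l 2 : ℤ) : ℝ) := by
    rw [hpar3]; push_cast; ring
  rcases hP with h | h | h | h <;> rw [h] at hpar3' <;> push_cast at hpar3'
  · left; linarith
  · right; left; linarith
  · right; right; left; linarith
  · right; right; right; linarith

/-- **The sharp tilt bound.**  For unit vectors `n, m` with `⟪n, m⟫ = ±1/3`,
`(√8·|⟪m,e₃⟫| − √(1 − ⟪m,e₃⟫²))/3 ≤ √(1 − ⟪n,e₃⟫²)`: a `{111}` plane at `70.53°` from the shared axis is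
tilted from horizontal by at least `70.53° − θ`. -/
theorem tilt_ge_of_inner_eq_third {n m : EuclideanSpace ℝ (Fin 3)} (hn : ‖n‖ = 1) (hm : ‖m‖ = 1)
    (hnm : ⟪n, m⟫_ℝ = 1 / 3 ∨ ⟪n, m⟫_ℝ = -(1 / 3)) :
    (Real.sqrt 8 * |⟪m, EuclideanSpace.single (2 : Fin 3) (1 : ℝ)⟫_ℝ| -
        Real.sqrt (1 - ⟪m, EuclideanSpace.single (2 : Fin 3) (1 : ℝ)⟫_ℝ ^ 2)) / 3 ≤
      Real.sqrt (1 - ⟪n, EuclideanSpace.single (2 : Fin 3) (1 : ℝ)⟫_ℝ ^ 2) := by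
  set e₃ : EuclideanSpace ℝ (Fin 3) := EuclideanSpace.single (2 : Fin 3) (1 : ℝ) with he₃
  have he₃n : ‖e₃‖ = 1 := by rw [he₃, PiLp.norm_single, norm_one]
  set c : ℝ := ⟪m, e₃⟫_ℝ with hc
  set s : ℝ := Real.sqrt (1 - c ^ 2) with hs
  have mm : ⟪m, m⟫_ℝ = 1 := by rw [real_inner_self_eq_norm_sq, hm, one_pow]
  have nn : ⟪n, n⟫_ℝ = 1 := by rw [real_inner_self_eq_norm_sq, hn, one_pow]
  have ee : ⟪e₃, e₃⟫_ℝ = 1 := by rw [real_inner_self_eq_norm_sq, he₃n, one_pow]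
  have hc1 : c ^ 2 ≤ 1 := by
    have := abs_real_inner_le_norm m e₃
    rw [hm, he₃n, one_mul] at this
    have h0 := abs_nonneg ⟪m, e₃⟫_ℝ
    rw [← sq_abs]; nlinarith
  have hs2 : s ^ 2 = 1 - c ^ 2 := by rw [hs, Real.sq_sqrt (by linarith)]
  have hs0 : 0 ≤ s := Real.sqrt_nonneg _
  -- `g = e₃ − c m`, `‖g‖ = s`, `g ⊥ m`
  set g : EuclideanSpace ℝ (Fin 3) := e₃ - c • m with hg
  have hgm : ⟪g, m⟫_ℝ = 0 := by
    rw [hg, inner_sub_left, real_inner_smul_left, mm, real_inner_comm, ← hc]; ring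
  have hgg : ⟪g, g⟫_ℝ = s ^ 2 := by
    rw [hs2, hg]
    simp only [inner_sub_left, inner_sub_right, real_inner_smul_left, real_inner_smul_right]
    rw [ee, mm, real_inner_comm m e₃, ← hc]; ring
  have hgn : ‖g‖ = s := by
    have : ‖g‖ ^ 2 = s ^ 2 := by rw [← real_inner_self_eq_norm_sq, hgg]
    nlinarith [norm_nonneg g, hs0]
  -- `n⊥ = n − ⟪n,m⟫ m`, `‖n⊥‖² = 8/9`
  set a : ℝ := ⟪n, m⟫_ℝ with ha
  have ha2 : a ^ 2 = 1 / 9 := by rcases hnm with h | h <;> rw [h] <;> norm_num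
  set p : EuclideanSpace ℝ (Fin 3) := n - a • m with hp
  have hpp : ⟪p, p⟫_ℝ = 8 / 9 := by
    rw [hp]
    simp only [inner_sub_left, inner_sub_right, real_inner_smul_left, real_inner_smul_right]
    rw [nn, mm, real_inner_comm n m, ← ha]; nlinarith [ha2]
  have hpn : ‖p‖ = Real.sqrt 8 / 3 := by
    have h1 : ‖p‖ ^ 2 = 8 / 9 := by rw [← real_inner_self_eq_norm_sq, hpp]
    have h2 : (Real.sqrt 8 / 3) ^ 2 = 8 / 9 := by rw [div_pow, Real.sq_sqrt (by norm_num)]; norm_num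
    have h3 : 0 ≤ Real.sqrt 8 / 3 := by positivity
    nlinarith [norm_nonneg p]
  -- `⟪n, e₃⟫ = a c + ⟪p, g⟫`
  have hdec : ⟪n, e₃⟫_ℝ = a * c + ⟪p, g⟫_ℝ := by
    have h1 : e₃ = g + c • m := by rw [hg]; abel
    have h2 : ⟪p, g⟫_ℝ = ⟪n, g⟫_ℝ := by
      rw [hp, inner_sub_left, real_inner_smul_left, real_inner_comm g m, hgm, mul_zero, sub_zero]
    rw [h1, inner_add_right, real_inner_smul_right, ← ha, h2]; ring
  have hpg : |⟪p, g⟫_ℝ| ≤ Real.sqrt 8 / 3 * s := by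
    have := abs_real_inner_le_norm p g; rwa [hpn, hgn] at this
  -- `|⟪n,e₃⟫| ≤ |c|/3 + (√8/3) s =: B`
  have habs_a : |a| = 1 / 3 := by
    rcases hnm with h | h
    · rw [h]; norm_num
    · rw [h, abs_neg]; norm_num
  have hB : |⟪n, e₃⟫_ℝ| ≤ |c| / 3 + Real.sqrt 8 / 3 * s := by
    rw [hdec]
    calc |a * c + ⟪p, g⟫_ℝ| ≤ |a * c| + |⟪p, g⟫_ℝ| := abs_add_le _ _
      _ = |c| / 3 + |⟪p, g⟫_ℝ| := by rw [abs_mul, habs_a]; ring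
      _ ≤ |c| / 3 + Real.sqrt 8 / 3 * s := by linarith
  -- squares: `B² + ((√8|c| − s)/3)² = c² + s² = 1`
  have h8 : Real.sqrt 8 ^ 2 = 8 := Real.sq_sqrt (by norm_num)
  have hcs : |c| ^ 2 + s ^ 2 = 1 := by rw [sq_abs]; linarith [hs2]
  have hkey : ((Real.sqrt 8 * |c| - s) / 3) ^ 2 ≤ 1 - ⟪n, e₃⟫_ℝ ^ 2 := by
    have hB0 : 0 ≤ |c| / 3 + Real.sqrt 8 / 3 * s := by positivity
    have hx2 : ⟪n, e₃⟫_ℝ ^ 2 ≤ (|c| / 3 + Real.sqrt 8 / 3 * s) ^ 2 := by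
      rw [← sq_abs]
      exact pow_le_pow_left₀ (abs_nonneg _) hB 2
    have e : (|c| / 3 + Real.sqrt 8 / 3 * s) ^ 2 + ((Real.sqrt 8 * |c| - s) / 3) ^ 2 = |c| ^ 2 + s ^ 2 := by
      linear_combination ((|c| ^ 2 + s ^ 2) / 9) * h8
    linarith
  by_cases hneg : Real.sqrt 8 * |c| - s < 0
  · exact le_trans (by linarith) (Real.sqrt_nonneg _)
  · push Not at hneg
    have h0 : 0 ≤ (Real.sqrt 8 * |c| - s) / 3 := by linarith
    calc (Real.sqrt 8 * |c| - s) / 3 = Real.sqrt (((Real.sqrt 8 * |c| - s) / 3) ^ 2) := by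
          rw [Real.sqrt_sq h0]
      _ ≤ Real.sqrt (1 - ⟪n, e₃⟫_ℝ ^ 2) := Real.sqrt_le_sqrt hkey

/-- **Descent rate of every foreign plate of a co-axial grain.**  Under the crux's co-axiality hypothesis
for grain 1, every unit menu normal `n ≠ ±L e₃` of the grain satisfies
`(√3/6)·(√8·|⟪L e₃, e₃⟫| − √(1 − ⟪L e₃, e₃⟫²)) ≤ (√3/2)·√(1 − ⟪n, e₃⟫²)` — the descent-rate input of
`twinDozen_plateFoot_payer` for EVERY foreign plate, positive exactly when `tan ∠(e₃, L e₃) < √8`. -/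
theorem foreign_descent_rate_of_coaxial
    (A₁ : EuclideanSpace ℝ (Fin 3) ≃ₗᵢ[ℝ] EuclideanSpace ℝ (Fin 3)) (t₁ : EuclideanSpace ℝ (Fin 3))
    (L : EuclideanSpace ℝ (Fin 3) ≃ₗᵢ[ℝ] EuclideanSpace ℝ (Fin 3)) (s₁ : EuclideanSpace ℝ (Fin 3)) (σ : ℤ → ℤ)
    (hsub : (fun p => A₁ p + t₁) '' fccStacking 1 (Real.sqrt (2 / 3)) ⊆
      (fun p => L p + s₁) '' barlowStacking 1 (Real.sqrt (2 / 3)) σ)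
    {n : EuclideanSpace ℝ (Fin 3)} (hn : ‖n‖ = 1)
    (hmenu : ∀ w ∈ fccSlots, ⟪A₁ w, n⟫_ℝ = 0 ∨ ⟪A₁ w, n⟫_ℝ = Real.sqrt (2 / 3) ∨ ⟪A₁ w, n⟫_ℝ = -Real.sqrt (2 / 3))
    (hne : n ≠ L (EuclideanSpace.single (2 : Fin 3) (1 : ℝ)))
    (hne' : n ≠ -L (EuclideanSpace.single (2 : Fin 3) (1 : ℝ))) :
    Real.sqrt 3 / 6 * (Real.sqrt 8 * |⟪L (EuclideanSpace.single (2 : Fin 3) (1 : ℝ)),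
        EuclideanSpace.single (2 : Fin 3) (1 : ℝ)⟫_ℝ| -
        Real.sqrt (1 - ⟪L (EuclideanSpace.single (2 : Fin 3) (1 : ℝ)),
          EuclideanSpace.single (2 : Fin 3) (1 : ℝ)⟫_ℝ ^ 2)) ≤
      Real.sqrt 3 / 2 * Real.sqrt (1 - ⟪n, EuclideanSpace.single (2 : Fin 3) (1 : ℝ)⟫_ℝ ^ 2) := by
  set e₃ : EuclideanSpace ℝ (Fin 3) := EuclideanSpace.single (2 : Fin 3) (1 : ℝ) with he₃
  have hLe₃ : ‖L e₃‖ = 1 := by rw [LinearIsometryEquiv.norm_map, he₃, PiLp.norm_single, norm_one]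
  have hmenum := menu_axis_of_coaxial A₁ t₁ L s₁ σ hsub
  have h := inner_menu_normals A₁ hn hLe₃ hmenu hmenum
  rcases h with h1 | h1 | h3
  · exact absurd ((inner_eq_one_iff_of_norm_eq_one (𝕜 := ℝ) hn hLe₃).1 h1) hne
  · exact absurd ((inner_eq_neg_one_iff_of_norm_eq_one (𝕜 := ℝ) hn hLe₃).1 h1) hne'
  · have := tilt_ge_of_inner_eq_third hn hLe₃ h3
    have h30 : 0 ≤ Real.sqrt 3 := Real.sqrt_nonneg 3
    have := mul_le_mul_of_nonneg_left this h30
    linarith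

end Summit.Ventures.Crystal3D.Theorems

end
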